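import Mathlib
import Summits.KontsevichZagierPeriods.KontsevichZagierPeriods.Theorems.InverseLandauTateFamilyKernelOpenCube

/-!
# Crux `TateFamilyKernel` (stmt-KontsevichZagierPeriods-9130), line `Sketch` — constructors of the research stub's
normal form for kinds (d) and (e)

The research stub `stub_descentTate N` (Lines/Sketch.lean of the crux) asserts the existence of descent data of three
kinds — (a) Ayoub elements, (d) hyperoctahedral differences, (e) products with lower Tate vanishing families — summing
pointwise to the fibre. These two elementary constructors show that its `∃`-format is inhabited by a single kind-(d)
element and by a single kind-(e) element (format sanity for `m = 0`); the kind-(a) constructors are `stub_descentOfExact`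
(`m = 0`, exact families, via `stub_exactWall`) and `stub_descentOfFold2` (`m = 1`, fold transport elements).
-/

noncomputable section

open MeasureTheory Set MvPolynomial
open Literature.NumberTheory.Transcendental

namespace Summit.KontsevichZagierPeriods.InverseLandau.TateFamilyKernel.Descent

/-- CONSTRUCTOR (proved): hyperoctahedral elements inhabit the research stub's normal form (`m = 0`, `L = 1`, no Ayoub
and no product terms): if the fibre `P/Q(·,ϖ₀)` is `h − h∘g` on the closed cube with `h = B₀/E₀` (`E₀ ≠ 0` there) and
`g = (σ₀, S₀)` hyperoctahedral, the `∃` of `stub_descentTate N` holds. [cite: KontsevichZagier2001, §1.2] -/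
theorem descentOfOdd (N : ℕ) (P Q B₀ E₀ : MvPolynomial (Fin (N + 2 + 1)) ℚ)
    (σ₀ : Equiv.Perm (Fin (N + 2))) (S₀ : Finset (Fin (N + 2))) (ϖ₀ : ℝ)
    (hE₀ : ∀ w ∈ KZ.cube (N + 2), aeval (Fin.snoc w ϖ₀ : Fin (N + 2 + 1) → ℝ) E₀ ≠ 0)
    (hfib : ∀ w ∈ KZ.cube (N + 2),
      aeval (Fin.snoc w ϖ₀ : Fin (N + 2 + 1) → ℝ) P / aeval (Fin.snoc w ϖ₀ : Fin (N + 2 + 1) → ℝ) Q =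
        aeval (Fin.snoc w ϖ₀ : Fin (N + 2 + 1) → ℝ) B₀ / aeval (Fin.snoc w ϖ₀ : Fin (N + 2 + 1) → ℝ) E₀ -
          aeval (Fin.snoc (fun t => if t ∈ S₀ then 1 - w (σ₀ t) else w (σ₀ t)) ϖ₀ : Fin (N + 2 + 1) → ℝ) B₀ /
            aeval (Fin.snoc (fun t => if t ∈ S₀ then 1 - w (σ₀ t) else w (σ₀ t)) ϖ₀ : Fin (N + 2 + 1) → ℝ) E₀) :
    ∃ (m K : ℕ) (A Dn : Fin K → MvPolynomial (Fin (N + 2 + m + 1)) ℚ) (i : Fin K → Fin (N + 2 + m))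
        (L : ℕ) (B E : Fin L → MvPolynomial (Fin (N + 2 + m + 1)) ℚ)
        (σ : Fin L → Equiv.Perm (Fin (N + 2 + m))) (S : Fin L → Finset (Fin (N + 2 + m)))
        (J : ℕ) (d c : Fin J → ℕ) (e : ∀ j, Fin (d j + c j) ≃ Fin (N + 2 + m))
        (Pj Qj : ∀ j, MvPolynomial (Fin (d j + 1)) ℚ) (bj : Fin J → ℝ)
        (Bj Ej : ∀ j, MvPolynomial (Fin (c j + 1)) ℚ),
        (∀ k, ∀ w ∈ KZ.cube (N + 2 + m), aeval (Fin.snoc w ϖ₀ : Fin (N + 2 + m + 1) → ℝ) (Dn k) ≠ 0) ∧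
        (∀ l, ∀ w ∈ KZ.cube (N + 2 + m), aeval (Fin.snoc w ϖ₀ : Fin (N + 2 + m + 1) → ℝ) (E l) ≠ 0) ∧
        (∀ j, d j ≤ N + 1) ∧
        (∀ j, ∃ c₀ : ℚ, c₀ ≠ 0 ∧ ∀ y : Fin (d j) → ℝ,
          aeval (Fin.snoc y (0 : ℝ) : Fin (d j + 1) → ℝ) (Qj j) = (c₀ : ℝ)) ∧
        (∀ j (y : Fin (d j) → ℝ) (ϖ : ℝ), (∀ t, y t ∈ Icc (0 : ℝ) 1) → ϖ ∈ Ioo 0 (bj j) →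
          aeval (Fin.snoc y ϖ : Fin (d j + 1) → ℝ) (Qj j) ≠ 0) ∧
        (∀ j, ∀ ϖ ∈ Ioo 0 (bj j), ∫ y in Set.pi Set.univ (fun _ : Fin (d j) => Ioo (0 : ℝ) 1),
          aeval (Fin.snoc y ϖ : Fin (d j + 1) → ℝ) (Pj j) / aeval (Fin.snoc y ϖ : Fin (d j + 1) → ℝ) (Qj j) = 0) ∧
        (∀ j, ϖ₀ ∈ Ioo 0 (bj j)) ∧
        (∀ j, ∀ y ∈ KZ.cube (c j), aeval (Fin.snoc y ϖ₀ : Fin (c j + 1) → ℝ) (Ej j) ≠ 0) ∧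
        (∀ w ∈ KZ.cube (N + 2 + m),
          aeval (Fin.snoc (fun t => w (Fin.castAdd m t)) ϖ₀ : Fin (N + 2 + 1) → ℝ) P /
              aeval (Fin.snoc (fun t => w (Fin.castAdd m t)) ϖ₀ : Fin (N + 2 + 1) → ℝ) Q =
            (∑ k : Fin K,
              (aeval (Fin.snoc w ϖ₀ : Fin (N + 2 + m + 1) → ℝ)
                  (pderiv (Fin.castSucc (i k)) (A k) * Dn k - A k * pderiv (Fin.castSucc (i k)) (Dn k)) /
                aeval (Fin.snoc w ϖ₀ : Fin (N + 2 + m + 1) → ℝ) (Dn k ^ 2)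
              - aeval (Fin.snoc (Function.update w (i k) 1) ϖ₀ : Fin (N + 2 + m + 1) → ℝ) (A k) /
                  aeval (Fin.snoc (Function.update w (i k) 1) ϖ₀ : Fin (N + 2 + m + 1) → ℝ) (Dn k)
              + aeval (Fin.snoc (Function.update w (i k) 0) ϖ₀ : Fin (N + 2 + m + 1) → ℝ) (A k) /
                  aeval (Fin.snoc (Function.update w (i k) 0) ϖ₀ : Fin (N + 2 + m + 1) → ℝ) (Dn k))) +
            (∑ l : Fin L,
              (aeval (Fin.snoc w ϖ₀ : Fin (N + 2 + m + 1) → ℝ) (B l) /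
                  aeval (Fin.snoc w ϖ₀ : Fin (N + 2 + m + 1) → ℝ) (E l) -
                aeval (Fin.snoc (fun t => if t ∈ S l then 1 - w (σ l t) else w (σ l t)) ϖ₀ :
                    Fin (N + 2 + m + 1) → ℝ) (B l) /
                  aeval (Fin.snoc (fun t => if t ∈ S l then 1 - w (σ l t) else w (σ l t)) ϖ₀ :
                    Fin (N + 2 + m + 1) → ℝ) (E l))) +
            (∑ j : Fin J,
              aeval (Fin.snoc (fun t => w (e j (Fin.castAdd (c j) t))) ϖ₀ : Fin (d j + 1) → ℝ) (Pj j) /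
                  aeval (Fin.snoc (fun t => w (e j (Fin.castAdd (c j) t))) ϖ₀ : Fin (d j + 1) → ℝ) (Qj j) *
                (aeval (Fin.snoc (fun t => w (e j (Fin.natAdd (d j) t))) ϖ₀ : Fin (c j + 1) → ℝ) (Bj j) /
                  aeval (Fin.snoc (fun t => w (e j (Fin.natAdd (d j) t))) ϖ₀ : Fin (c j + 1) → ℝ) (Ej j)))) := by
  refine ⟨0, 0, Fin.elim0, Fin.elim0, Fin.elim0, 1, fun _ => B₀, fun _ => E₀, fun _ => σ₀, fun _ => S₀,
    0, Fin.elim0, Fin.elim0, fun j => j.elim0, fun j => j.elim0, fun j => j.elim0, Fin.elim0,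
    fun j => j.elim0, fun j => j.elim0, ?_, ?_, ?_, ?_, ?_, ?_, ?_, ?_, ?_⟩
  · intro k; exact k.elim0
  · intro _ w hw; exact hE₀ w hw
  · intro j; exact j.elim0
  · intro j; exact j.elim0
  · intro j; exact j.elim0
  · intro j; exact j.elim0
  · intro j; exact j.elim0
  · intro j; exact j.elim0
  · intro w hw
    simp only [Finset.univ_eq_empty, Finset.sum_empty, zero_add, add_zero, Finset.univ_unique,
      Finset.sum_singleton]
    exact hfib w hw

/-- CONSTRUCTOR (proved): product elements inhabit the research stub's normal form (`m = 0`, `J = 1`, no Ayoub and no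
symmetry terms): if the fibre `P/Q(·,ϖ₀)` on the closed cube is `(P₁/Q₁)(w ∘ e₀ ∘ castAdd, ϖ₀) · (B₁/E₁)(w ∘ e₀ ∘ natAdd, ϖ₀)`
with `(P₁, Q₁)` a Tate family of dimension `d₀ ≤ N + 1` admissible and vanishing on `(0,b₁) ∋ ϖ₀` and `E₁ ≠ 0` on the closed
`c₀`-cube, the `∃` of `stub_descentTate N` holds. [cite: KontsevichZagier2001, §1.2] -/
theorem descentOfProduct (N d₀ c₀ : ℕ) (P Q : MvPolynomial (Fin (N + 2 + 1)) ℚ) (e₀ : Fin (d₀ + c₀) ≃ Fin (N + 2))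
    (P₁ Q₁ : MvPolynomial (Fin (d₀ + 1)) ℚ) (b₁ : ℝ) (B₁ E₁ : MvPolynomial (Fin (c₀ + 1)) ℚ) (ϖ₀ : ℝ)
    (hd₀ : d₀ ≤ N + 1)
    (hT₁ : ∃ c₀' : ℚ, c₀' ≠ 0 ∧ ∀ y : Fin d₀ → ℝ, aeval (Fin.snoc y (0 : ℝ) : Fin (d₀ + 1) → ℝ) Q₁ = (c₀' : ℝ))
    (hadm₁ : ∀ (y : Fin d₀ → ℝ) (ϖ : ℝ), (∀ t, y t ∈ Icc (0 : ℝ) 1) → ϖ ∈ Ioo 0 b₁ →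
      aeval (Fin.snoc y ϖ : Fin (d₀ + 1) → ℝ) Q₁ ≠ 0)
    (hvan₁ : ∀ ϖ ∈ Ioo 0 b₁, ∫ y in Set.pi Set.univ (fun _ : Fin d₀ => Ioo (0 : ℝ) 1),
      aeval (Fin.snoc y ϖ : Fin (d₀ + 1) → ℝ) P₁ / aeval (Fin.snoc y ϖ : Fin (d₀ + 1) → ℝ) Q₁ = 0)
    (hϖ₀ : ϖ₀ ∈ Ioo 0 b₁)
    (hE₁ : ∀ y ∈ KZ.cube c₀, aeval (Fin.snoc y ϖ₀ : Fin (c₀ + 1) → ℝ) E₁ ≠ 0)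
    (hfib : ∀ w ∈ KZ.cube (N + 2),
      aeval (Fin.snoc w ϖ₀ : Fin (N + 2 + 1) → ℝ) P / aeval (Fin.snoc w ϖ₀ : Fin (N + 2 + 1) → ℝ) Q =
        aeval (Fin.snoc (fun t => w (e₀ (Fin.castAdd c₀ t))) ϖ₀ : Fin (d₀ + 1) → ℝ) P₁ /
            aeval (Fin.snoc (fun t => w (e₀ (Fin.castAdd c₀ t))) ϖ₀ : Fin (d₀ + 1) → ℝ) Q₁ *
          (aeval (Fin.snoc (fun t => w (e₀ (Fin.natAdd d₀ t))) ϖ₀ : Fin (c₀ + 1) → ℝ) B₁ /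
            aeval (Fin.snoc (fun t => w (e₀ (Fin.natAdd d₀ t))) ϖ₀ : Fin (c₀ + 1) → ℝ) E₁)) :
    ∃ (m K : ℕ) (A Dn : Fin K → MvPolynomial (Fin (N + 2 + m + 1)) ℚ) (i : Fin K → Fin (N + 2 + m))
        (L : ℕ) (B E : Fin L → MvPolynomial (Fin (N + 2 + m + 1)) ℚ)
        (σ : Fin L → Equiv.Perm (Fin (N + 2 + m))) (S : Fin L → Finset (Fin (N + 2 + m)))
        (J : ℕ) (d c : Fin J → ℕ) (e : ∀ j, Fin (d j + c j) ≃ Fin (N + 2 + m))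
        (Pj Qj : ∀ j, MvPolynomial (Fin (d j + 1)) ℚ) (bj : Fin J → ℝ)
        (Bj Ej : ∀ j, MvPolynomial (Fin (c j + 1)) ℚ),
        (∀ k, ∀ w ∈ KZ.cube (N + 2 + m), aeval (Fin.snoc w ϖ₀ : Fin (N + 2 + m + 1) → ℝ) (Dn k) ≠ 0) ∧
        (∀ l, ∀ w ∈ KZ.cube (N + 2 + m), aeval (Fin.snoc w ϖ₀ : Fin (N + 2 + m + 1) → ℝ) (E l) ≠ 0) ∧
        (∀ j, d j ≤ N + 1) ∧
        (∀ j, ∃ c₀ : ℚ, c₀ ≠ 0 ∧ ∀ y : Fin (d j) → ℝ,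
          aeval (Fin.snoc y (0 : ℝ) : Fin (d j + 1) → ℝ) (Qj j) = (c₀ : ℝ)) ∧
        (∀ j (y : Fin (d j) → ℝ) (ϖ : ℝ), (∀ t, y t ∈ Icc (0 : ℝ) 1) → ϖ ∈ Ioo 0 (bj j) →
          aeval (Fin.snoc y ϖ : Fin (d j + 1) → ℝ) (Qj j) ≠ 0) ∧
        (∀ j, ∀ ϖ ∈ Ioo 0 (bj j), ∫ y in Set.pi Set.univ (fun _ : Fin (d j) => Ioo (0 : ℝ) 1),
          aeval (Fin.snoc y ϖ : Fin (d j + 1) → ℝ) (Pj j) / aeval (Fin.snoc y ϖ : Fin (d j + 1) → ℝ) (Qj j) = 0) ∧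
        (∀ j, ϖ₀ ∈ Ioo 0 (bj j)) ∧
        (∀ j, ∀ y ∈ KZ.cube (c j), aeval (Fin.snoc y ϖ₀ : Fin (c j + 1) → ℝ) (Ej j) ≠ 0) ∧
        (∀ w ∈ KZ.cube (N + 2 + m),
          aeval (Fin.snoc (fun t => w (Fin.castAdd m t)) ϖ₀ : Fin (N + 2 + 1) → ℝ) P /
              aeval (Fin.snoc (fun t => w (Fin.castAdd m t)) ϖ₀ : Fin (N + 2 + 1) → ℝ) Q =
            (∑ k : Fin K,
              (aeval (Fin.snoc w ϖ₀ : Fin (N + 2 + m + 1) → ℝ)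
                  (pderiv (Fin.castSucc (i k)) (A k) * Dn k - A k * pderiv (Fin.castSucc (i k)) (Dn k)) /
                aeval (Fin.snoc w ϖ₀ : Fin (N + 2 + m + 1) → ℝ) (Dn k ^ 2)
              - aeval (Fin.snoc (Function.update w (i k) 1) ϖ₀ : Fin (N + 2 + m + 1) → ℝ) (A k) /
                  aeval (Fin.snoc (Function.update w (i k) 1) ϖ₀ : Fin (N + 2 + m + 1) → ℝ) (Dn k)
              + aeval (Fin.snoc (Function.update w (i k) 0) ϖ₀ : Fin (N + 2 + m + 1) → ℝ) (A k) /
                  aeval (Fin.snoc (Function.update w (i k) 0) ϖ₀ : Fin (N + 2 + m + 1) → ℝ) (Dn k))) +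
            (∑ l : Fin L,
              (aeval (Fin.snoc w ϖ₀ : Fin (N + 2 + m + 1) → ℝ) (B l) /
                  aeval (Fin.snoc w ϖ₀ : Fin (N + 2 + m + 1) → ℝ) (E l) -
                aeval (Fin.snoc (fun t => if t ∈ S l then 1 - w (σ l t) else w (σ l t)) ϖ₀ :
                    Fin (N + 2 + m + 1) → ℝ) (B l) /
                  aeval (Fin.snoc (fun t => if t ∈ S l then 1 - w (σ l t) else w (σ l t)) ϖ₀ :
                    Fin (N + 2 + m + 1) → ℝ) (E l))) +
            (∑ j : Fin J,
              aeval (Fin.snoc (fun t => w (e j (Fin.castAdd (c j) t))) ϖ₀ : Fin (d j + 1) → ℝ) (Pj j) /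
                  aeval (Fin.snoc (fun t => w (e j (Fin.castAdd (c j) t))) ϖ₀ : Fin (d j + 1) → ℝ) (Qj j) *
                (aeval (Fin.snoc (fun t => w (e j (Fin.natAdd (d j) t))) ϖ₀ : Fin (c j + 1) → ℝ) (Bj j) /
                  aeval (Fin.snoc (fun t => w (e j (Fin.natAdd (d j) t))) ϖ₀ : Fin (c j + 1) → ℝ) (Ej j)))) := by
  refine ⟨0, 0, Fin.elim0, Fin.elim0, Fin.elim0, 0, Fin.elim0, Fin.elim0, Fin.elim0, Fin.elim0,
    1, fun _ => d₀, fun _ => c₀, fun _ => e₀, fun _ => P₁, fun _ => Q₁, fun _ => b₁, fun _ => B₁, fun _ => E₁,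
    ?_, ?_, ?_, ?_, ?_, ?_, ?_, ?_, ?_⟩
  · intro k; exact k.elim0
  · intro l; exact l.elim0
  · intro _; exact hd₀
  · intro _; exact hT₁
  · intro _ y ϖ hy hϖ; exact hadm₁ y ϖ hy hϖ
  · intro _ ϖ hϖ; exact hvan₁ ϖ hϖ
  · intro _; exact hϖ₀
  · intro _ y hy; exact hE₁ y hy
  · intro w hw
    simp only [Finset.univ_eq_empty, Finset.sum_empty, zero_add, Finset.univ_unique, Finset.sum_singleton]
    exact hfib w hw

end Summit.KontsevichZagierPeriods.InverseLandau.TateFamilyKernel.Descent
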